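import Summits.MatrixMultiplication.MatrixMultiplication.Theorems.FarEdgeDescentTowerDeviation
import HarnessLib

/-!
# Far-edge descent, kernel XXX-B3: dynamics of the full-class crude tower — the rate record
`e(x) = O(x^(−0.4269…))` at the far edge

Route `FarEdgeDescent` (cut of record `closes : FiniteSaturation → AnchoredLogConvexity →
MatrixMultiplication`), special leaf `FiniteSaturation` (stmt-MatrixMultiplication-23739): helper
kernel, THESES-FREE and def-free; third of the XXX-B files.  It consumes ONLY the numbers exported
by kernel XXX-A (`FarEdgeDescentTowerChain.crudeTowerChain_two K 7`, the clock-`7` full-class crude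
tower on `⟨2,1,2⟩ ⊕ ⟨1,2,1⟩`, `bR ≤ 6`) through XXX-B1/B2, and proves the wedge
`s − 1 ≤ C·(1 − t)^κ`, `κ = log₇(179/100) = 0.2992…`, for every sub-tangent `(s,t)` of
`y ↦ ω(1,y,1)` (`virtualPowerBound_tower`); kernel XXVII's tensor-free conversion
`excess_le_const_mul_rpow_of_virtualPowerBound` then gives the rate
`e(x) ≤ C'·x^(−κ/(1−κ))`, `κ/(1−κ) = 0.4269… > 21/50 > log 2/log(11/2) = 0.4066` (kernel XXVI's
pair order): `excess_le_rpow_towerOrder`, `rateBeyond_of_lt_towerOrder`,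
`rateBeyond_of_le_twentyOne_fiftieths`.

## Mechanism (Pan's clock / Lotti–Romani acceleration, read through the virtual spectral point)

The legs ratio `m_j = L_j/r_j` runs the one-dimensional system `m_{j+1} = f(m_j)`,
`f = φ/(1+φ)`, `φ(m) = (1−m)⁷ − (1−2m)⁷`, from `m₀ = 1/3` into the `f`-invariant box
`[43/250, 177/1000]` (from `j = 9`, XXX-B1); the virtual deviation `D_j = γ_j − m_j` starts at
`D₀ ≥ v/5` and grows by the factor `λ(m_j) ≥ 179/100` on the box (`≥ 1/20` before), up to losses
`14·3u·7ʲ` from the anchor weight `Q_j^(−u)` (XXX-B2), while the cap keeps `D_j ≤ 7/10`.  Hence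
(`core_bound`) `(1/20)⁹·(v/5)·(179/100)^M < 9/10` whenever `3u·7^(M+8) ≤ 1/100`; choosing
`M + 8 = ⌊log₇(1/(300u))⌋` gives `v ≤ C·u^κ` with `179/100 = 7^κ` (§5), and `u = 0` forces `v = 0`.

Tags: `FiniteSaturation` (h₁) NEC · WEAKER (`RateBeyond θ` for `θ ≤ 21/50` are now theorems) ·
ATTACKED; `AnchoredLogConvexity` (h₂) untouched.  The instrumented limit order of this tower is
`κ*/(1−κ*) = 0.4486` (`κ* = log₇ λ(m*)`, `m* = 0.17461` the fixed point of `f`); shrinking the box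
towards `m*` lifts `21/50` towards it; the improvable (Stothers) variant of the same clock has
order `log(4/3)/log(3/2) = 0.7095` but needs a Literature notion of improvable approximate
realisations.

References: Pan 1984 (LNCS 179) §17, Thm. 17.1 (the clock); Lotti–Romani 1983, Thm. 3.1 and
Prop. 4.1 (acceleration, `ω(1,k,1) ≤ k + 1 + O(k^(−δ))` shape); Coppersmith–Winograd 1982 (the
`⟨1,R−Σ,1⟩` augmentation); Alman–Duan–Vassilevska Williams–Xu–Xu–Zhou 2025 §1 (context).
-/

set_option linter.dupNamespace false

noncomputable section

open scoped BigOperators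

namespace Summit.MatrixMultiplication.MatrixMultiplication.Theorems.FarEdgeDescentTowerDynamics

open Literature.Computability.AlgebraicComplexity
open Summit.MatrixMultiplication.MatrixMultiplication.Theorems.FarEdgeDescentTowerRatio
open Summit.MatrixMultiplication.MatrixMultiplication.Theorems.FarEdgeDescentTowerDeviation

variable (K : Type) [Field K]

/-! ## §4 The deviation induction and the violation -/

section Core

variable (r Q L : ℕ → ℕ) (G : ℕ → ℝ → ℝ → ℝ)

/-- **Core.**  On a sub-tangent `(s,t)` with `(1−t)·3·7^(M+8) ≤ 1/100` the amplified initial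
deviation `(1/20)⁹·((s−1)/5)·(179/100)^M` stays below `9/10`: otherwise the certified lower bounds,
transported through stages `0…8` (multiplier `≥ 1/20`) and `9…M+8` (multiplier `≥ 179/100` on the
box), force `γ − m > 7/10` at stage `M+9`, violating the cap. [cite: Pan1984, Thm. 17.1;
LottiRomani1983, Thm. 3.1, Prop. 4.1] -/
theorem core_bound
    (h0r : r 0 = 6) (h0Q : Q 0 = 2) (h0L : L 0 = 2)
    (hG0 : ∀ s t : ℝ, G 0 s t = (2 : ℝ) ^ s)
    (hL : ∀ j, L (j + 1) = (Q j + L j) ^ 7 - Q j ^ 7) (hr : ∀ j, r (j + 1) = r j ^ 7 + L (j + 1))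
    (hQ : ∀ j, Q (j + 1) = r j ^ 7 - L (j + 1))
    (hG : ∀ j (s t : ℝ), G (j + 1) s t =
      (((Q j : ℕ) : ℝ) ^ t + G j s t) ^ 7 - (((Q j : ℕ) : ℝ) ^ t) ^ 7)
    (hQ1 : ∀ j, 1 ≤ Q j) (hall : ∀ j, (Q j + L j) ^ 7 ≤ r j ^ 7)
    (hread : ∀ j (s t : ℝ), (∀ y : ℝ, 0 ≤ y → s + y * t ≤ omegaRect K 1 y 1) →
      G (j + 1) s t ≤ ((r j : ℕ) : ℝ) ^ 7)
    {s t : ℝ} (ht1 : t ≤ 1) (hs1 : 1 ≤ s)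
    (hst : ∀ y : ℝ, 0 ≤ y → s + y * t ≤ omegaRect K 1 y 1) (M : ℕ)
    (hu : (1 - t) * (3 * 7 ^ (M + 8)) ≤ 1 / 100) :
    ((1 : ℝ) / 20) ^ 9 * ((s - 1) / 5) * ((179 : ℝ) / 100) ^ M < 9 / 10 := by
  by_contra HV
  push Not at HV
  have h0 : Q 0 + 2 * L 0 = r 0 := by rw [h0Q, h0L, h0r]
  have hsum := anchor_add_two_mul_legs r Q L hL hr hQ hall h0
  have SF := fun j => virtual_normalForm K r Q L G hL hr hQ1 hall h0r hsum hG0 hG hread ht1 hst j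
  have NF := fun j => step_normalForm r Q L hL hr hQ1 hsum j
  have MR := fun j => ratio_succ r Q L hL hr hQ1 hsum j
  have BOX := ratio_mem_box r Q L hL hr hQ hQ1 hall h0r h0Q h0L
  have hu0 : 0 ≤ 1 - t := by linarith
  have hv0 : 0 ≤ s - 1 := by linarith
  have hl0 : (0 : ℝ) < ((179 : ℝ) / 100) ^ M := by positivity
  -- HV in usable forms
  have HV' : (9 : ℝ) / 10 / ((179 : ℝ) / 100) ^ M ≤ ((1 : ℝ) / 20) ^ 9 * ((s - 1) / 5) := by
    rw [div_le_iff₀ hl0]; exact HV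
  -- generic transport at stage j ≤ M + 8
  have STEP : ∀ j, j ≤ M + 8 → ∀ lo a b : ℝ, 0 ≤ lo →
      lo ≤ 7 * (1 - (L j : ℝ) / r j) ^ 6 /
        (1 + ((1 - (L j : ℝ) / r j) ^ 7 - (1 - 2 * ((L j : ℝ) / r j)) ^ 7)) →
      0 ≤ a - b → a - b ≤ G j s t / r j - (L j : ℝ) / r j →
      lo * a - (lo * b + 14 * ((1 - t) * (3 * 7 ^ j))) ≤
        G (j + 1) s t / r (j + 1) - (L (j + 1) : ℝ) / r (j + 1) := by
    intro j hj lo a b hlo0 hlolam hab hD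
    obtain ⟨hθ0, hθρ, hdefj, hγ0, hcap, hrec⟩ := SF j
    obtain ⟨hrpos, hm0, hm1, -, -, -⟩ := NF j
    have hdef' : (1 - 2 * ((L j : ℝ) / r j)) - ((Q j : ℕ) : ℝ) ^ t / r j ≤ 1 / 100 := by
      refine le_trans hdefj (le_trans ?_ hu)
      have : (7 : ℝ) ^ j ≤ 7 ^ (M + 8) := pow_le_pow_right₀ (by norm_num) hj
      nlinarith
    have hφpos : 0 < 1 + ((1 - (L j : ℝ) / r j) ^ 7 - (1 - 2 * ((L j : ℝ) / r j)) ^ 7) := by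
      linarith [phi_nonneg hm0 hm1]
    have hm' : (L (j + 1) : ℝ) / r (j + 1) *
        (1 + ((1 - (L j : ℝ) / r j) ^ 7 - (1 - 2 * ((L j : ℝ) / r j)) ^ 7)) =
        (1 - (L j : ℝ) / r j) ^ 7 - (1 - 2 * ((L j : ℝ) / r j)) ^ 7 := by
      rw [MR j]; exact div_mul_cancel₀ _ hφpos.ne'
    exact deviation_transport hm0 hm1 hγ0 hθ0 hθρ hdef' hcap hrec hm' hlo0 hlolam hab hD
      (by linarith)
  -- loss bookkeeping
  have LB : ∀ j, j ≤ M + 8 → ∀ lo : ℝ, lo ≤ 179 / 100 →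
      lo * ((19 : ℝ) / 100 / 7 ^ (M + 8 + 1 - j)) + 14 * ((1 - t) * (3 * 7 ^ j)) ≤
        (19 : ℝ) / 100 / 7 ^ (M + 8 - j) :=
    fun j hj lo hlo => loss_budget hj hu hlo
  -- Phase 1: stages 0 … 9 with the crude multiplier 1/20
  have P1 : ∀ j, j ≤ 9 → ((1 : ℝ) / 20) ^ j * ((s - 1) / 5) - (19 : ℝ) / 100 / 7 ^ (M + 9 - j) ≤
      G j s t / r j - (L j : ℝ) / r j := by
    intro j
    induction j with
    | zero =>
      intro _
      have hI := initial_deviation r L G h0r h0L hG0 t hs1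
      have hb : (0 : ℝ) ≤ 19 / 100 / 7 ^ (M + 9 - 0) := by positivity
      simp only [pow_zero, one_mul]
      linarith
    | succ j ih =>
      intro hj9
      have hj : j ≤ M + 8 := by omega
      have ihj := ih (by omega)
      obtain ⟨hrpos, hm0, hm1, -, -, -⟩ := NF j
      -- nonnegativity of a_j - b_j from HV
      have ha : ((1 : ℝ) / 20) ^ 9 * ((s - 1) / 5) ≤ ((1 : ℝ) / 20) ^ j * ((s - 1) / 5) := by
        apply mul_le_mul_of_nonneg_right _ (by linarith)
        exact pow_le_pow_of_le_one (by norm_num) (by norm_num) (by omega)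
      have hb : (19 : ℝ) / 100 / 7 ^ (M + 9 - j) ≤ 9 / 10 / ((179 : ℝ) / 100) ^ M := by
        have h1 : ((179 : ℝ) / 100) ^ M ≤ 7 ^ M := pow_le_pow_left₀ (by norm_num) (by norm_num) M
        have h2 : (7 : ℝ) ^ M ≤ 7 ^ (M + 9 - j) := pow_le_pow_right₀ (by norm_num) (by omega)
        calc (19 : ℝ) / 100 / 7 ^ (M + 9 - j) ≤ 19 / 100 / ((179 : ℝ) / 100) ^ M :=
              div_le_div_of_nonneg_left (by norm_num) hl0 (h1.trans h2)
          _ ≤ 9 / 10 / ((179 : ℝ) / 100) ^ M := div_le_div_of_nonneg_right (by norm_num) hl0.le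
      have hab : 0 ≤ ((1 : ℝ) / 20) ^ j * ((s - 1) / 5) - 19 / 100 / 7 ^ (M + 9 - j) := by
        linarith
      have hS := STEP j hj (1 / 20) _ _ (by norm_num) (lambda_ge_crude hm0 hm1) hab ihj
      have hLB := LB j hj (1 / 20) (by norm_num)
      have e1 : (M + 8 + 1 - j) = (M + 9 - j) := by omega
      have e2 : (M + 8 - j) = (M + 9 - (j + 1)) := by omega
      rw [e1, e2] at hLB
      have e3 : ((1 : ℝ) / 20) ^ (j + 1) * ((s - 1) / 5) = 1 / 20 * (((1 : ℝ) / 20) ^ j * ((s - 1) / 5)) := by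
        rw [pow_succ]; ring
      rw [e3]
      linarith
  -- Phase 2: stages 9 … M+9 with the box multiplier 179/100
  have P2 : ∀ k, k ≤ M →
      ((1 : ℝ) / 20) ^ 9 * ((s - 1) / 5) * ((179 : ℝ) / 100) ^ k - (19 : ℝ) / 100 / 7 ^ (M - k) ≤
      G (9 + k) s t / r (9 + k) - (L (9 + k) : ℝ) / r (9 + k) := by
    intro k
    induction k with
    | zero =>
      intro _
      have := P1 9 le_rfl
      simp only [pow_zero, mul_one, Nat.add_zero]
      have e : M + 9 - 9 = M - 0 := by omega
      rw [e] at this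
      exact this
    | succ k ih =>
      intro hk
      have hj : 9 + k ≤ M + 8 := by omega
      have ihk := ih (by omega)
      obtain ⟨hrpos, hm0, hm1, -, -, -⟩ := NF (9 + k)
      have hbox := BOX (9 + k) (by omega)
      have hlam := lambda_ge_of_mem_box hbox.1 hbox.2
      -- nonnegativity
      have hsplit : ((179 : ℝ) / 100) ^ M = ((179 : ℝ) / 100) ^ k * ((179 : ℝ) / 100) ^ (M - k) := by
        rw [← pow_add, Nat.add_sub_cancel' (by omega : k ≤ M)]
      have hlk : (0 : ℝ) < ((179 : ℝ) / 100) ^ k := by positivity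
      have hlMk : (0 : ℝ) < ((179 : ℝ) / 100) ^ (M - k) := by positivity
      have ha : 9 / 10 / ((179 : ℝ) / 100) ^ (M - k) ≤
          ((1 : ℝ) / 20) ^ 9 * ((s - 1) / 5) * ((179 : ℝ) / 100) ^ k := by
        rw [div_le_iff₀ hlMk, mul_assoc, ← hsplit]
        exact HV
      have hb : (19 : ℝ) / 100 / 7 ^ (M - k) ≤ 9 / 10 / ((179 : ℝ) / 100) ^ (M - k) := by
        have h1 : ((179 : ℝ) / 100) ^ (M - k) ≤ 7 ^ (M - k) :=
          pow_le_pow_left₀ (by norm_num) (by norm_num) _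
        calc (19 : ℝ) / 100 / 7 ^ (M - k) ≤ 19 / 100 / ((179 : ℝ) / 100) ^ (M - k) :=
              div_le_div_of_nonneg_left (by norm_num) hlMk h1
          _ ≤ 9 / 10 / ((179 : ℝ) / 100) ^ (M - k) :=
              div_le_div_of_nonneg_right (by norm_num) hlMk.le
      have hab : 0 ≤ ((1 : ℝ) / 20) ^ 9 * ((s - 1) / 5) * ((179 : ℝ) / 100) ^ k -
          19 / 100 / 7 ^ (M - k) := by linarith
      have hS := STEP (9 + k) hj (179 / 100) _ _ (by norm_num) hlam hab ihk
      have hLB := LB (9 + k) hj (179 / 100) le_rfl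
      have e1 : (M + 8 + 1 - (9 + k)) = (M - k) := by omega
      have e2 : (M + 8 - (9 + k)) = (M - (k + 1)) := by omega
      rw [e1, e2] at hLB
      have e3 : ((1 : ℝ) / 20) ^ 9 * ((s - 1) / 5) * ((179 : ℝ) / 100) ^ (k + 1) =
          179 / 100 * (((1 : ℝ) / 20) ^ 9 * ((s - 1) / 5) * ((179 : ℝ) / 100) ^ k) := by
        rw [pow_succ]; ring
      have e4 : 9 + (k + 1) = 9 + k + 1 := by omega
      rw [e3, e4]
      linarith
  -- the violation at stage M + 9
  have hfin := P2 M le_rfl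
  simp only [Nat.sub_self, pow_zero, div_one] at hfin
  obtain ⟨hθ0, hθρ, hdefj, hγ0, hcap, -⟩ := SF (9 + M)
  obtain ⟨hrpos, hm0, hm1, -, -, -⟩ := NF (9 + M)
  have hdef7 : (1 - 2 * ((L (9 + M) : ℝ) / r (9 + M))) - ((Q (9 + M) : ℕ) : ℝ) ^ t / r (9 + M) ≤
      7 / 100 := by
    refine le_trans hdefj ?_
    have : (7 : ℝ) ^ (9 + M) = 7 * 7 ^ (M + 8) := by
      rw [show 9 + M = (M + 8) + 1 by omega, pow_succ]; ring
    rw [this]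
    nlinarith
  have hviol := deviation_le_of_cap (γ := G (9 + M) s t / r (9 + M)) hθ0 (by linarith) hdef7 hcap
  linarith

end Core

/-! ## §5 The wedge `s − 1 ≤ C·(1−t)^κ`, `κ = log₇(179/100)` -/

/-- **The virtual power bound (wedge) at the far edge.**  Every sub-tangent `(s,t)` of
`y ↦ ω(1,y,1)` with `0 ≤ t ≤ 1 ≤ s ≤ 2` satisfies `s − 1 ≤ C·(1 − t)^κ` with
`κ = log₇(179/100) = 0.2992…`, from the clock-`7` full-class crude tower on `⟨2,1,2⟩ ⊕ ⟨1,2,1⟩`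
(`bR ≤ 6`). [cite: Pan1984, Thm. 17.1; LottiRomani1983, Thm. 3.1, Prop. 4.1;
AlmanDuanVassilevskaWilliamsXuXuZhou2025, §1] -/
theorem virtualPowerBound_tower :
    ∃ C : ℝ, 0 ≤ C ∧ ∀ s t : ℝ, 0 ≤ t → t ≤ 1 → 1 ≤ s → s ≤ 2 →
      (∀ y : ℝ, 0 ≤ y → s + y * t ≤ omegaRect K 1 y 1) →
      s - 1 ≤ C * (1 - t) ^ Real.logb 7 ((179 : ℝ) / 100) := by
  obtain ⟨r, Q, L, G, h0r, h0Q, h0L, hG0, hL, hr, hQ, hG, hQ1, hall, hread⟩ :=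
    FarEdgeDescentTowerChain.crudeTowerChain_two K 7
  have hκ0 := towerKappa_pos
  have hl1 : (1 : ℝ) < 179 / 100 := by norm_num
  refine ⟨9 / 2 * 20 ^ 9 * ((179 : ℝ) / 100) ^ 9 *
    (300 * 7 ^ 8 : ℝ) ^ Real.logb 7 ((179 : ℝ) / 100), by positivity, ?_⟩
  intro s t ht0 ht1 hs1 hs2 hst
  have hu0 : 0 ≤ 1 - t := by linarith
  -- the core bound in the form  s − 1 < A / l^M
  have cv : ∀ M : ℕ, (1 - t) * (3 * 7 ^ (M + 8)) ≤ 1 / 100 →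
      s - 1 < 9 / 2 * 20 ^ 9 / ((179 : ℝ) / 100) ^ M := by
    intro M hM
    have h := core_bound K r Q L G h0r h0Q h0L hG0 hL hr hQ hG hQ1 hall hread ht1 hs1 hst M hM
    have hlM : (0 : ℝ) < ((179 : ℝ) / 100) ^ M := by positivity
    rw [lt_div_iff₀ hlM]
    have e : ((1 : ℝ) / 20) ^ 9 * ((s - 1) / 5) * ((179 : ℝ) / 100) ^ M =
        (s - 1) * ((179 : ℝ) / 100) ^ M / (5 * 20 ^ 9) := by ring
    rw [e, div_lt_iff₀ (by positivity)] at h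
    linarith
  have hCκ : 0 ≤ (300 * 7 ^ 8 : ℝ) ^ Real.logb 7 ((179 : ℝ) / 100) *
      (1 - t) ^ Real.logb 7 ((179 : ℝ) / 100) := by positivity
  by_cases hu : 1 - t = 0
  · -- t = 1: every M is admissible, so s − 1 ≤ 0
    have hv : s - 1 ≤ 0 := by
      by_contra hpos
      push Not at hpos
      obtain ⟨M, hM⟩ := pow_unbounded_of_one_lt (9 / 2 * 20 ^ 9 / (s - 1)) hl1
      have h := cv M (by rw [hu]; norm_num)
      rw [div_lt_iff₀ hpos] at hM
      rw [lt_div_iff₀ (by positivity)] at h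
      linarith
    exact le_trans hv (by positivity)
  · have hupos : 0 < 1 - t := lt_of_le_of_ne hu0 (Ne.symm hu)
    by_cases hsmall : (1 - t) * (300 * 7 ^ 8) ≤ 1
    · -- X = 1/(300 u) ≥ 7^8, n = ⌊log₇ X⌋ ≥ 8, M = n − 8
      have hXpos : 0 < 1 / (300 * (1 - t)) := by positivity
      have hX8 : (7 : ℝ) ^ 8 ≤ 1 / (300 * (1 - t)) := by
        rw [le_div_iff₀ (by positivity)]; linarith
      have hl8 : (8 : ℝ) ≤ Real.logb 7 (1 / (300 * (1 - t))) := by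
        rw [Real.le_logb_iff_rpow_le (by norm_num) hXpos,
          show (8 : ℝ) = ((8 : ℕ) : ℝ) by norm_num, Real.rpow_natCast]
        exact hX8
      have hn8 : 8 ≤ ⌊Real.logb 7 (1 / (300 * (1 - t)))⌋₊ := Nat.le_floor (by exact_mod_cast hl8)
      have hnle : (⌊Real.logb 7 (1 / (300 * (1 - t)))⌋₊ : ℝ) ≤ Real.logb 7 (1 / (300 * (1 - t))) :=
        Nat.floor_le (by linarith)
      have hnlt := Nat.lt_floor_add_one (Real.logb 7 (1 / (300 * (1 - t))))
      have h7n : (7 : ℝ) ^ ⌊Real.logb 7 (1 / (300 * (1 - t)))⌋₊ ≤ 1 / (300 * (1 - t)) := by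
        have := Real.rpow_le_rpow_of_exponent_le (by norm_num : (1 : ℝ) ≤ 7) hnle
        rwa [Real.rpow_natCast, Real.rpow_logb (by norm_num) (by norm_num) hXpos] at this
      have hM : (1 - t) * (3 * 7 ^ ((⌊Real.logb 7 (1 / (300 * (1 - t)))⌋₊ - 8) + 8)) ≤ 1 / 100 := by
        rw [Nat.sub_add_cancel hn8]
        calc (1 - t) * (3 * 7 ^ ⌊Real.logb 7 (1 / (300 * (1 - t)))⌋₊)
            ≤ (1 - t) * (3 * (1 / (300 * (1 - t)))) := by gcongr
          _ = 1 / 100 := by field_simp; norm_num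
      have hv := cv _ hM
      -- compare l^(n-8) with l^(log₇ X − 9) = X^κ / l^9
      have e1 : ((179 : ℝ) / 100) ^ (Real.logb 7 (1 / (300 * (1 - t))) - 9) ≤
          ((179 : ℝ) / 100) ^ (⌊Real.logb 7 (1 / (300 * (1 - t)))⌋₊ - 8) := by
        have h := Real.rpow_le_rpow_of_exponent_le hl1.le
          (show Real.logb 7 (1 / (300 * (1 - t))) - 9 ≤
            ((⌊Real.logb 7 (1 / (300 * (1 - t)))⌋₊ - 8 : ℕ) : ℝ) by
              push_cast [Nat.cast_sub hn8]; linarith)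
        rwa [Real.rpow_natCast] at h
      have e2 : ((179 : ℝ) / 100) ^ (Real.logb 7 (1 / (300 * (1 - t))) - 9) =
          (1 / (300 * (1 - t))) ^ Real.logb 7 ((179 : ℝ) / 100) / ((179 : ℝ) / 100) ^ 9 := by
        rw [Real.rpow_sub (by norm_num), show (9 : ℝ) = ((9 : ℕ) : ℝ) by norm_num,
          Real.rpow_natCast]
        congr 1
        rw [Real.rpow_def_of_pos (by norm_num), Real.rpow_def_of_pos hXpos, Real.logb, Real.logb]
        congr 1
        have h7 : Real.log 7 ≠ 0 := Real.log_ne_zero_of_pos_of_ne_one (by norm_num) (by norm_num)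
        field_simp
      have e3 : (1 / (300 * (1 - t))) ^ Real.logb 7 ((179 : ℝ) / 100) =
          ((300 * (1 - t)) ^ Real.logb 7 ((179 : ℝ) / 100))⁻¹ := by
        rw [one_div, Real.inv_rpow (by positivity)]
      have hXκ : 0 < (300 * (1 - t)) ^ Real.logb 7 ((179 : ℝ) / 100) := by positivity
      have e4 : (300 * (1 - t)) ^ Real.logb 7 ((179 : ℝ) / 100) ≤
          (300 * 7 ^ 8 : ℝ) ^ Real.logb 7 ((179 : ℝ) / 100) *
            (1 - t) ^ Real.logb 7 ((179 : ℝ) / 100) := by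
        rw [Real.mul_rpow (by norm_num) hu0]
        apply mul_le_mul_of_nonneg_right _ (by positivity)
        exact Real.rpow_le_rpow (by norm_num) (by norm_num) hκ0.le
      -- assemble
      have hlpow : (0 : ℝ) < ((179 : ℝ) / 100) ^ (⌊Real.logb 7 (1 / (300 * (1 - t)))⌋₊ - 8) := by
        positivity
      have step1 : 9 / 2 * 20 ^ 9 / ((179 : ℝ) / 100) ^ (⌊Real.logb 7 (1 / (300 * (1 - t)))⌋₊ - 8) ≤
          9 / 2 * 20 ^ 9 / (((179 : ℝ) / 100) ^ (Real.logb 7 (1 / (300 * (1 - t))) - 9)) :=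
        div_le_div_of_nonneg_left (by positivity) (by rw [e2, e3]; positivity) e1
      rw [e2, e3] at step1
      have step2 : 9 / 2 * 20 ^ 9 /
          (((300 * (1 - t)) ^ Real.logb 7 ((179 : ℝ) / 100))⁻¹ / ((179 : ℝ) / 100) ^ 9) =
          9 / 2 * 20 ^ 9 * ((179 : ℝ) / 100) ^ 9 * (300 * (1 - t)) ^ Real.logb 7 ((179 : ℝ) / 100) := by
        field_simp
      rw [step2] at step1
      have step3 : 9 / 2 * 20 ^ 9 * ((179 : ℝ) / 100) ^ 9 *
          (300 * (1 - t)) ^ Real.logb 7 ((179 : ℝ) / 100) ≤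
          9 / 2 * 20 ^ 9 * ((179 : ℝ) / 100) ^ 9 *
            ((300 * 7 ^ 8 : ℝ) ^ Real.logb 7 ((179 : ℝ) / 100) *
              (1 - t) ^ Real.logb 7 ((179 : ℝ) / 100)) :=
        mul_le_mul_of_nonneg_left e4 (by positivity)
      linarith
    · -- u large: s − 1 ≤ 1 ≤ (300·7⁸·u)^κ
      push Not at hsmall
      have h1 : (1 : ℝ) ≤ (300 * 7 ^ 8 * (1 - t)) ^ Real.logb 7 ((179 : ℝ) / 100) :=
        Real.one_le_rpow (by linarith) hκ0.le
      rw [Real.mul_rpow (by norm_num) hu0] at h1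
      have hA : (1 : ℝ) ≤ 9 / 2 * 20 ^ 9 * ((179 : ℝ) / 100) ^ 9 := by norm_num
      have hv1 : s - 1 ≤ 1 := by linarith
      nlinarith [mul_le_mul hA h1 (by norm_num) (by positivity)]

/-! ## §6 Rate: `e(x) ≤ C'·x^(−κ/(1−κ))`, `κ/(1−κ) = 0.4269… > 0.40660 = log 2/log(11/2)` -/

/-- **Rate at the tower order.**  `e(x) = ω(1,x,1) − (x+1) ≤ C'·x^(−κ/(1−κ))` for all `x > 0`,
`κ = log₇(179/100)`; exponent `κ/(1−κ) = 0.4269…`, beyond the pair order `log 2/log(11/2) =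
0.4066` of kernel XXVI. [cite: Pan1984, Thm. 17.1; LottiRomani1983, Prop. 4.1;
AlmanDuanVassilevskaWilliamsXuXuZhou2025, §1] -/
theorem excess_le_rpow_towerOrder :
    ∃ C : ℝ, ∀ x : ℝ, 0 < x → omegaRect K 1 x 1 - (x + 1) ≤
      C * x ^ (-(Real.logb 7 ((179 : ℝ) / 100) / (1 - Real.logb 7 ((179 : ℝ) / 100)))) := by
  obtain ⟨C, hC, hV⟩ := virtualPowerBound_tower K
  exact ⟨_, fun x hx => FarEdgeDescentVirtualPoint.excess_le_const_mul_rpow_of_virtualPowerBound K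
    hC towerKappa_pos towerKappa_lt_one hV hx⟩

/-- **`RateBeyond θ` for every `θ < κ/(1−κ)`** (`= 0.4269…`), in the `PowerAmortisation` /
`RateBeyond` shape of the route (`∃ δ > θ, ∃ C, ∀ k ≥ 1, e(k) ≤ C·k^(−δ)`).  Lifts kernel XXVI's
`rateBeyond_of_lt_pairOrder` (`θ < 0.4066`). [cite: LottiRomani1983, Prop. 4.1; Pan1984, Thm. 17.1] -/
theorem rateBeyond_of_lt_towerOrder {θ : ℝ}
    (hθ : θ < Real.logb 7 ((179 : ℝ) / 100) / (1 - Real.logb 7 ((179 : ℝ) / 100))) :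
    ∃ δ C : ℝ, θ < δ ∧ ∀ k : ℕ, 1 ≤ k →
      omegaRect K 1 k 1 - (k + 1) ≤ C * (k : ℝ) ^ (-δ) := by
  obtain ⟨C, hC⟩ := excess_le_rpow_towerOrder K
  refine ⟨_, C, hθ, fun k hk => ?_⟩
  have hkpos : (0 : ℝ) < k := by exact_mod_cast hk
  exact hC k hkpos


/-- **`RateBeyond θ` for every `θ ≤ 21/50`** — in particular beyond the pair order `0.4066`.
[cite: LottiRomani1983, Prop. 4.1; Pan1984, Thm. 17.1] -/
theorem rateBeyond_of_le_twentyOne_fiftieths {θ : ℝ} (hθ : θ ≤ 21 / 50) :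
    ∃ δ C : ℝ, θ < δ ∧ ∀ k : ℕ, 1 ≤ k →
      omegaRect K 1 k 1 - (k + 1) ≤ C * (k : ℝ) ^ (-δ) :=
  rateBeyond_of_lt_towerOrder K (lt_of_le_of_lt hθ towerOrder_gt)

end Summit.MatrixMultiplication.MatrixMultiplication.Theorems.FarEdgeDescentTowerDynamics

end
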